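import Summits.HodgeConjecture.HodgeConjecture.Theorems.R90S4TwistedCartanNormFibres   -- ★ p863634 (this seat) FILE α: `epsNorm_mul_epsLoc_inv`, `epsConjClassesMod_mk_eq_mk_iff`; brings ★ p863295 CartanNormMap (`mem_epsCentralizer_iff_of_mem_centralizer`, `epsLoc_mem_centralizer_coe`, `epsNorm_mul_of_mem_centralizer`), ★ p863195 EpsCanonicalAtPoint (`IsEpsCanonicalAt.classEpsOrbitalIntegral_mk_eq_epsOrbitalIntegral`, `descEpsConj_mk`), ★ p862879 B3-2 (`map_apply_compactCore`, `isInvInvariant_map_of_continuousMulEquiv`), ★ `Literature.MeasureTheory.Group.InvariantQuotientTransport` (`cosetCongr`, `map_cosetCongr_quotientMeasure`)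
import HarnessLib

/-!
# R90-TF · S4 «Ch. 13.1–2», T-WIF road, head M3 (CAN-ID) + INNER-C — ALONG `T̃^{ε-reg}` EVERY SUMMAND `Φ_ε(⟦t⟧, φ)` IS AN INTEGRAL OVER ONE BASE QUOTIENT
# `G̃_v ⧸ G̃_{t₀ε}` AGAINST ONE MEASURE `dνGt ∕ dτ₀`, and it only depends on `t · (1−ε)T̃` (Rogawski 1990, §12.5 p. 186; §4.3 p. 43; §4.10 p. 57)

Cell `hodgecm-mathlib`, crux H413 (`stmt-HodgeConjecture-24833`, lane `--supports … --as helper`), route of record `HCCMUnconditional` (no route verbs;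
count-neutral).  Programme R90-TF, section S4 = [Rogawski1990] Ch. 13.1–13.2; seat R90-C131-p03 (g2); FILE β of the HEADS SHEET `R90/R90-C131-p03/g2/HEADS-TWIF-tube.md`
(S4 dealer K2E2-plan (g7), S4-R26 (1) «β = M3 CAN-ID + INNER-C next»).  THEOREMS ONLY — no `def`, no instance, no notation, no named-fact hypothesis, no `sorry`;
★-only imports (one S4 `Theorems` file of this seat), never `Lines`.

HONEST LABEL: HC_CM is proved only modulo the 7 printed citations (2 remaining named inputs: hLiu418 = stmt-HodgeConjecture-24832, h413 =
stmt-HodgeConjecture-24833) until rung 0 closes.  Measure transport along EQUAL ε-centralisers; discharges no socket — the twisted Jacobian, «compatible measures»,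
(NORM-RAT), (DICT)∕(WEYL-COUNT) are untouched (REL ≠ ★ ≠ BUILT).

## The mathematics

The ε-twisted tube map of a Cartan `T = Z_G(γ)` (`γ ∈ G_v` regular, `T̃ = Cent_{G̃_v}(γ)`) is `Ψ_T (x T′, t) = x t ε(x)⁻¹` on `(G̃_v ⧸ T′) × T̃^{ε-reg}` with ONE subgroup
`T′ = G̃_{tε}` for ALL ε-regular `t ∈ T̃` (★ p863295 `mem_epsCentralizer_iff_of_mem_centralizer`: `g ∈ G̃_{tε} ↔ ε g = g ∧ g ∈ T̃`).  The inner integral of the twisted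
Weyl integration formula [Rogawski1990 §12.5 p. 186] at the torus point `t` is `∫_{G̃_v ⧸ T′} φ(x t ε(x)⁻¹) d(νGt ∕ τ)(x)`, while the tree's summand of
`Φ^{st}_ε` is `classEpsOrbitalIntegral mGt φ ⟦t⟧` — an integral over `G̃_v ⧸ G̃_{(out ⟦t⟧) ε}` against the pinned member `mGt ⟦t⟧`.  For an ε-CANONICAL family
(★ `IsEpsCanonicalAt … νGt mGt`: the member at an ε-regular class is `dνGt ∕ dt` for THE compact-core-normalised Haar measure of the ε-centraliser, §4.3 «compatible
measures») the two agree: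
* §1 (generic group `G`, any `ε`) `descEpsConj_cosetCongr_refl_apply` — the descended integrand `y ↦ φ(y δ ε(y)⁻¹)` is natural along the identity map of coset spaces
  `G ⧸ M → G ⧸ M′` for `M, M′ ≤ G̃_{δε}` with the same elements; `classEpsOrbitalIntegral_mk_mul_mul_inv_eq_of_commute` — INNER-C on classes: for `s` commuting with `t`,
  `⟦t · s ε(s)⁻¹⟧ = ⟦t⟧` (witness `s`), so `Φ_ε(⟦t · s ε(s)⁻¹⟧, φ) = Φ_ε(⟦t⟧, φ)`.
* §2 (S4) `epsCentralizer_eq_of_mem_centralizer` — `G̃_{tε} = G̃_{t₀ε}` for ε-regular `t, t₀ ∈ T̃` (EPS-CENT-CONST); and **CAN-ID**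
  `IsEpsCanonicalAt.classEpsOrbitalIntegral_mk_eq_integral_descEpsConj_base`: fix an ε-regular base point `t₀ ∈ T̃` and THE normalised Haar measure `τ₀` of `G̃_{t₀ε}`; then for
  EVERY ε-regular `t ∈ T̃` and every `φ`, `classEpsOrbitalIntegral mGt φ ⟦t⟧ = ∫_{G̃_v ⧸ G̃_{t₀ε}} φ(x t ε(x)⁻¹) d(quotientMeasure G̃_{t₀ε} τ₀ νGt)(x)` — proof: ★ p863195 at `t`
  with `τ₀` transported along `G̃_{t₀ε} = G̃_{tε}` (still Haar, inversion invariant, compact-core mass one: ★ p862879), then naturality of the quotient measure along the identity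
  ★ `map_cosetCongr_quotientMeasure` (`e = refl`, `νGt` unchanged) and §1.  Corollary (INNER-C on the base) `…_mul_mul_epsLoc_inv`: the base integral at `t · s ε(s)⁻¹`
  (`s ∈ T̃`) equals the one at `t`.
So the torus variable of T-WIF may run over `T̃^{ε-reg}` (or `T̃ ⧸ (1−ε)T̃`) with a `t`-INDEPENDENT quotient and measure — the shape the generic twisted radial formula (M2)
produces — and its integrand is the tree's class ε-orbital integral on the nose.

[cite: Rogawski1990, §12.5 p. 186; §4.3 (4.3.1) p. 43; §4.10 (4.10.1) p. 57; §3.11 Prop. 3.11.2 pp. 34–35] [cite: DeitmarEchterhoff2014, Thm. 1.5.3]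
-/

set_option autoImplicit false
-- the mandated namespace repeats the single-problem summit's segment (`HodgeConjecture.HodgeConjecture`)
set_option linter.dupNamespace false

noncomputable section

open MeasureTheory
open scoped NumberField Matrix MatrixGroups

namespace Summit.HodgeConjecture.HodgeConjecture.R90.S4

open Literature.NumberTheory.Rogawski1990 Literature.NumberTheory.Rogawski1990.Ch4Sec10
open Literature.NumberTheory.Automorphic Literature.MeasureTheory.Group
open IsDedekindDomain NumberField

/-! ## §1 Generic: naturality of the descended twisted integrand along the identity of coset spaces; INNER-C on classes -/

section Generic

variable {G : Type*} [Group G] (ε : G →* G)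

/-- **The descended twisted integrand is natural along the identity `G ⧸ M → G ⧸ M′`** for two subgroups `M, M′ ≤ G̃_{δε}` with the same elements:
`descEpsConj ε δ M′ φ (cosetCongr 1 (g M)) = descEpsConj ε δ M φ (g M) = φ(g δ ε(g)⁻¹)` (★ `descEpsConj_mk` twice). [cite: Rogawski1990, §4.10 (4.10.1) p. 57] -/
theorem descEpsConj_cosetCongr_refl_apply {δ : G} {M M' : Subgroup G} (hM : M ≤ epsCentralizer ε δ) (hM' : M' ≤ epsCentralizer ε δ)
    (hMM' : ∀ g, (MulEquiv.refl G) g ∈ M' ↔ g ∈ M) {α : Type*} (φ : G → α) (x : G ⧸ M) :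
    descEpsConj ε δ M' φ (cosetCongr (MulEquiv.refl G) M M' hMM' x) = descEpsConj ε δ M φ x := by
  induction x using QuotientGroup.induction_on with
  | H g => rw [cosetCongr_mk, MulEquiv.refl_apply, descEpsConj_mk ε hM', descEpsConj_mk ε hM]

/-- **INNER-C ON CLASSES**: for `s` commuting with `t`, `t · s ε(s)⁻¹ = s t ε(s)⁻¹` lies in the ε-class of `t`, so every class function — in particular the class
ε-orbital integral of any family — takes the same value: `Φ_ε(⟦t · s ε(s)⁻¹⟧, φ) = Φ_ε(⟦t⟧, φ)`.  On an abelian ε-stable `T̃` this is the `(1−ε)T̃`-invariance of the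
inner integral of the twisted Weyl formula. [cite: Rogawski1990, §12.5 p. 186; §1.4 p. 4] -/
theorem classEpsOrbitalIntegral_mk_mul_mul_inv_eq_of_commute [∀ δ : G, MeasurableSpace (G ⧸ epsCentralizer ε δ)] (m : EpsOrbitalMeasureFamily ε ⊥)
    {E : Type*} [NormedAddCommGroup E] [NormedSpace ℝ E] (φ : G → E) {t s : G} (h : s * t = t * s) :
    classEpsOrbitalIntegral ε m φ (Quotient.mk (Relation.EqvGen.setoid (epsConjModRel ε ⊥)) (t * (s * (ε s)⁻¹)) : EpsConjClassesMod ε ⊥) =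
      classEpsOrbitalIntegral ε m φ (Quotient.mk (Relation.EqvGen.setoid (epsConjModRel ε ⊥)) t) := by
  have hc : (Quotient.mk (Relation.EqvGen.setoid (epsConjModRel ε ⊥)) t : EpsConjClassesMod ε ⊥) =
      Quotient.mk (Relation.EqvGen.setoid (epsConjModRel ε ⊥)) (t * (s * (ε s)⁻¹)) :=
    Quotient.sound (Relation.EqvGen.rel _ _ (Or.inl ⟨s, by rw [h, mul_assoc]⟩))
  rw [hc]

end Generic

/-! ## §2 At the S4 carriers: the ε-centraliser is constant along `T̃^{ε-reg}`, and CAN-ID on the base quotient -/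

section Base

variable {L : Type} [Field L] [NumberField L] [IsCMField L] {Φ : GL (Fin 3) L}
  {v : HeightOneSpectrum (𝓞 ↥(maximalRealSubfield L))}

/-- **EPS-CENT-CONST**: for `γ ∈ G_v` regular and ε-regular `t, t₀ ∈ T̃ = Cent(γ)` (hermitian `Φ`), `G̃_{tε} = G̃_{t₀ε}` — both are `{g ∈ T̃ : ε g = g} = ι(G_{v,γ})`
(★ `mem_epsCentralizer_iff_of_mem_centralizer`). [cite: Rogawski1990, §3.11 Prop. 3.11.2 pp. 34–35; §12.5 p. 186] -/
theorem epsCentralizer_eq_of_mem_centralizer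
    (hΦ : ((Φ : GL (Fin 3) L) : Matrix (Fin 3) (Fin 3) L)ᵀ.map (IsCMField.complexConj L) = (Φ : Matrix (Fin 3) (Fin 3) L))
    {γ : (UnitaryGroup.cmDatum L 3 (Φ : Matrix (Fin 3) (Fin 3) L)).Local v} (hγ : IsRegularElt (γ.val : GtLoc L v)) {t t₀ : GtLoc L v}
    (ht : t ∈ Subgroup.centralizer ({(γ.val : GtLoc L v)} : Set (GtLoc L v))) (hreg : IsEpsRegularAt L Φ v t)
    (ht₀ : t₀ ∈ Subgroup.centralizer ({(γ.val : GtLoc L v)} : Set (GtLoc L v))) (hreg₀ : IsEpsRegularAt L Φ v t₀) :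
    epsCentralizer (epsLoc L Φ v) t = epsCentralizer (epsLoc L Φ v) t₀ := by
  ext g
  rw [mem_epsCentralizer_iff_of_mem_centralizer hΦ hγ ht hreg g, mem_epsCentralizer_iff_of_mem_centralizer hΦ hγ ht₀ hreg₀ g]

/-- `G̃_{t₀ε} ≤ G̃_{tε}` along `T̃^{ε-reg}` (the inequality form of EPS-CENT-CONST, as consumed by ★ `descEpsConj_mk`: on the base quotient the descended integrand at `t`
reads `φ(x t ε(x)⁻¹)` at every representative). [cite: Rogawski1990, §12.5 p. 186] -/
theorem epsCentralizer_le_of_mem_centralizer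
    (hΦ : ((Φ : GL (Fin 3) L) : Matrix (Fin 3) (Fin 3) L)ᵀ.map (IsCMField.complexConj L) = (Φ : Matrix (Fin 3) (Fin 3) L))
    {γ : (UnitaryGroup.cmDatum L 3 (Φ : Matrix (Fin 3) (Fin 3) L)).Local v} (hγ : IsRegularElt (γ.val : GtLoc L v)) {t t₀ : GtLoc L v}
    (ht : t ∈ Subgroup.centralizer ({(γ.val : GtLoc L v)} : Set (GtLoc L v))) (hreg : IsEpsRegularAt L Φ v t)
    (ht₀ : t₀ ∈ Subgroup.centralizer ({(γ.val : GtLoc L v)} : Set (GtLoc L v))) (hreg₀ : IsEpsRegularAt L Φ v t₀) :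
    epsCentralizer (epsLoc L Φ v) t₀ ≤ epsCentralizer (epsLoc L Φ v) t :=
  (epsCentralizer_eq_of_mem_centralizer hΦ hγ ht hreg ht₀ hreg₀).ge

/-- **On the base quotient the descended integrand at `t` is `φ(x t ε(x)⁻¹)`** (for ε-regular `t, t₀ ∈ T̃`): `descEpsConj ε t G̃_{t₀ε} φ (x G̃_{t₀ε}) = φ (x t ε(x)⁻¹)`.
[cite: Rogawski1990, §12.5 p. 186; §4.10 (4.10.1) p. 57] -/
theorem descEpsConj_base_mk
    (hΦ : ((Φ : GL (Fin 3) L) : Matrix (Fin 3) (Fin 3) L)ᵀ.map (IsCMField.complexConj L) = (Φ : Matrix (Fin 3) (Fin 3) L))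
    {γ : (UnitaryGroup.cmDatum L 3 (Φ : Matrix (Fin 3) (Fin 3) L)).Local v} (hγ : IsRegularElt (γ.val : GtLoc L v)) {t t₀ : GtLoc L v}
    (ht : t ∈ Subgroup.centralizer ({(γ.val : GtLoc L v)} : Set (GtLoc L v))) (hreg : IsEpsRegularAt L Φ v t)
    (ht₀ : t₀ ∈ Subgroup.centralizer ({(γ.val : GtLoc L v)} : Set (GtLoc L v))) (hreg₀ : IsEpsRegularAt L Φ v t₀)
    {α : Type*} (φ : GtLoc L v → α) (x : GtLoc L v) :
    descEpsConj (epsLoc L Φ v) t (epsCentralizer (epsLoc L Φ v) t₀) φ (QuotientGroup.mk x) = φ (x * t * (epsLoc L Φ v x)⁻¹) :=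
  descEpsConj_mk (epsLoc L Φ v) (epsCentralizer_le_of_mem_centralizer hΦ hγ ht hreg ht₀ hreg₀) φ x

/-- **`t · s ε(s)⁻¹` stays in `T̃` and stays ε-regular** for `t ∈ T̃` ε-regular and `s ∈ T̃` (`N(t · s ε(s)⁻¹) = N t`: `N` multiplicative on `T̃`, `N(s ε(s)⁻¹) = 1`).
[cite: Rogawski1990, §12.5 p. 186] -/
theorem mem_centralizer_and_isEpsRegularAt_mul_mul_epsLoc_inv
    (hΦ : ((Φ : GL (Fin 3) L) : Matrix (Fin 3) (Fin 3) L)ᵀ.map (IsCMField.complexConj L) = (Φ : Matrix (Fin 3) (Fin 3) L))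
    {γ : (UnitaryGroup.cmDatum L 3 (Φ : Matrix (Fin 3) (Fin 3) L)).Local v} (hγ : IsRegularElt (γ.val : GtLoc L v)) {t s : GtLoc L v}
    (ht : t ∈ Subgroup.centralizer ({(γ.val : GtLoc L v)} : Set (GtLoc L v))) (hreg : IsEpsRegularAt L Φ v t)
    (hs : s ∈ Subgroup.centralizer ({(γ.val : GtLoc L v)} : Set (GtLoc L v))) :
    t * (s * (epsLoc L Φ v s)⁻¹) ∈ Subgroup.centralizer ({(γ.val : GtLoc L v)} : Set (GtLoc L v)) ∧
      IsEpsRegularAt L Φ v (t * (s * (epsLoc L Φ v s)⁻¹)) ∧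
        epsNorm (epsLoc L Φ v) (t * (s * (epsLoc L Φ v s)⁻¹)) = epsNorm (epsLoc L Φ v) t := by
  have hsC : s * (epsLoc L Φ v s)⁻¹ ∈ Subgroup.centralizer ({(γ.val : GtLoc L v)} : Set (GtLoc L v)) :=
    Subgroup.mul_mem _ hs (Subgroup.inv_mem _ (epsLoc_mem_centralizer_coe γ hs))
  have hN : epsNorm (epsLoc L Φ v) (t * (s * (epsLoc L Φ v s)⁻¹)) = epsNorm (epsLoc L Φ v) t := by
    rw [epsNorm_mul_of_mem_centralizer hγ ht hsC, epsNorm_mul_epsLoc_inv hΦ s, mul_one]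
  refine ⟨Subgroup.mul_mem _ ht hsC, ?_, hN⟩
  rw [isEpsRegularAt_iff, hN]
  exact (isEpsRegularAt_iff L Φ v t).1 hreg

variable [LocallyCompactSpace (GtLoc L v)] [SecondCountableTopology (GtLoc L v)] [T2Space (GtLoc L v)]
  [MeasurableSpace (GtLoc L v)] [BorelSpace (GtLoc L v)]
  [∀ δ : GtLoc L v, MeasurableSpace (GtLoc L v ⧸ epsCentralizer (epsLoc L Φ v) δ)]
  [∀ δ : GtLoc L v, BorelSpace (GtLoc L v ⧸ epsCentralizer (epsLoc L Φ v) δ)]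
  {νGt : Measure (GtLoc L v)} [νGt.IsHaarMeasure] [νGt.IsMulRightInvariant]
  {mGt : EpsOrbitalMeasureFamily (epsLoc L Φ v) ⊥}

/-- **CAN-ID — THE SUMMANDS OF `Φ^{st}_ε` ALONG `T̃^{ε-reg}` ON ONE BASE QUOTIENT.**  Let `Φ` be hermitian, `mGt` ε-canonical for `νGt` (★ `IsEpsCanonicalAt`), `γ ∈ G_v` regular,
`t₀ ∈ T̃ = Cent(γ)` ε-regular, and `τ₀` THE Haar measure of `G̃_{t₀ε}` (inversion invariant, mass one on the compact core).  Then for EVERY ε-regular `t ∈ T̃` and every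
Banach-valued `φ`:  `classEpsOrbitalIntegral mGt φ ⟦t⟧ = ∫_{G̃_v ⧸ G̃_{t₀ε}} φ(x t ε(x)⁻¹) d(dνGt ∕ dτ₀)(x)` — ONE quotient, ONE measure for the whole torus (the inner
integral of the twisted Weyl integration formula, p. 186, IS the tree's class ε-orbital integral).  Proof: `G̃_{tε} = G̃_{t₀ε}` (EPS-CENT-CONST); transport `τ₀` to `G̃_{tε}`
along the identity (Haar, inversion invariant, compact-core mass one: ★ p862879); ★ p863195 `classEpsOrbitalIntegral_mk_eq_epsOrbitalIntegral` at `t`; naturality of the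
quotient measure along the identity of coset spaces ★ `map_cosetCongr_quotientMeasure` (`e = refl`, `νGt ↦ νGt`); §1 `descEpsConj_cosetCongr_refl_apply`.
[cite: Rogawski1990, §12.5 p. 186; §4.3 (4.3.1) p. 43; §4.10 (4.10.1) p. 57] [cite: DeitmarEchterhoff2014, Thm. 1.5.3] -/
theorem IsEpsCanonicalAt.classEpsOrbitalIntegral_mk_eq_integral_descEpsConj_base
    (hΦ : ((Φ : GL (Fin 3) L) : Matrix (Fin 3) (Fin 3) L)ᵀ.map (IsCMField.complexConj L) = (Φ : Matrix (Fin 3) (Fin 3) L))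
    (hcan : IsEpsCanonicalAt L Φ v νGt mGt)
    {γ : (UnitaryGroup.cmDatum L 3 (Φ : Matrix (Fin 3) (Fin 3) L)).Local v} (hγ : IsRegularElt (γ.val : GtLoc L v))
    {t₀ : GtLoc L v} (ht₀ : t₀ ∈ Subgroup.centralizer ({(γ.val : GtLoc L v)} : Set (GtLoc L v))) (hreg₀ : IsEpsRegularAt L Φ v t₀)
    (τ₀ : Measure ↥(epsCentralizer (epsLoc L Φ v) t₀)) [τ₀.IsHaarMeasure] [τ₀.IsInvInvariant]
    (h1 : τ₀ (compactCore ↥(epsCentralizer (epsLoc L Φ v) t₀)) = 1)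
    {t : GtLoc L v} (ht : t ∈ Subgroup.centralizer ({(γ.val : GtLoc L v)} : Set (GtLoc L v))) (hreg : IsEpsRegularAt L Φ v t)
    {E : Type*} [NormedAddCommGroup E] [NormedSpace ℝ E] (φ : GtLoc L v → E) :
    classEpsOrbitalIntegral (epsLoc L Φ v) mGt φ
        (Quotient.mk (Relation.EqvGen.setoid (epsConjModRel (epsLoc L Φ v) ⊥)) t : EpsConjClassesMod (epsLoc L Φ v) ⊥) =
      ∫ q, descEpsConj (epsLoc L Φ v) t (epsCentralizer (epsLoc L Φ v) t₀) φ q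
        ∂(quotientMeasure (epsCentralizer (epsLoc L Φ v) t₀) τ₀ (isClosed_epsCentralizer L Φ v t₀) νGt) := by
  -- the two ε-centralisers have the same elements
  have hHH : ∀ g, (MulEquiv.refl (GtLoc L v)) g ∈ epsCentralizer (epsLoc L Φ v) t ↔ g ∈ epsCentralizer (epsLoc L Φ v) t₀ := fun g => by
    rw [MulEquiv.refl_apply, mem_epsCentralizer_iff_of_mem_centralizer hΦ hγ ht hreg g,
      mem_epsCentralizer_iff_of_mem_centralizer hΦ hγ ht₀ hreg₀ g]
  have he : Continuous (MulEquiv.refl (GtLoc L v)) := continuous_id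
  have hes : Continuous (MulEquiv.refl (GtLoc L v)).symm := continuous_id
  haveI hZ₀ : IsClosed ((epsCentralizer (epsLoc L Φ v) t₀ : Subgroup (GtLoc L v)) : Set (GtLoc L v)) := isClosed_epsCentralizer L Φ v t₀
  haveI hZ : IsClosed ((epsCentralizer (epsLoc L Φ v) t : Subgroup (GtLoc L v)) : Set (GtLoc L v)) := isClosed_epsCentralizer L Φ v t
  haveI : LocallyCompactSpace ↥(epsCentralizer (epsLoc L Φ v) t₀) := hZ₀.isClosedEmbedding_subtypeVal.locallyCompactSpace
  haveI : SecondCountableTopology ↥(epsCentralizer (epsLoc L Φ v) t₀) := TopologicalSpace.Subtype.secondCountableTopology _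
  haveI : LocallyCompactSpace ↥(epsCentralizer (epsLoc L Φ v) t) := hZ.isClosedEmbedding_subtypeVal.locallyCompactSpace
  haveI : SecondCountableTopology ↥(epsCentralizer (epsLoc L Φ v) t) := TopologicalSpace.Subtype.secondCountableTopology _
  -- the identity `G̃_{t₀ε} ≃ₜ* G̃_{tε}` and the transported normalising measure
  let eH : ↥(epsCentralizer (epsLoc L Φ v) t₀) ≃ₜ ↥(epsCentralizer (epsLoc L Φ v) t) :=
    subgroupCongrHomeomorph (MulEquiv.refl (GtLoc L v)) _ _ hHH he hes
  let eZ : ↥(epsCentralizer (epsLoc L Φ v) t₀) ≃ₜ* ↥(epsCentralizer (epsLoc L Φ v) t) :=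
    { toMulEquiv :=
        { toEquiv := eH.toEquiv
          map_mul' := fun a b => Subtype.ext (map_mul (MulEquiv.refl (GtLoc L v)) (a : GtLoc L v) (b : GtLoc L v)) }
      continuous_toFun := eH.continuous
      continuous_invFun := eH.symm.continuous }
  have heZ : (eZ : _ → ↥(epsCentralizer (epsLoc L Φ v) t)) = eH := rfl
  haveI : (Measure.map eH τ₀).IsHaarMeasure := by
    rw [← heZ]
    exact eZ.isHaarMeasure_map τ₀
  haveI : (Measure.map eH τ₀).IsInvInvariant := by
    rw [← heZ]
    exact isInvInvariant_map_of_continuousMulEquiv eZ eZ.continuous.measurable τ₀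
  have h1t : (Measure.map eH τ₀) (compactCore ↥(epsCentralizer (epsLoc L Φ v) t)) = 1 := by
    rw [← heZ, map_apply_compactCore eZ τ₀, h1]
  -- ★ p863195 at `t` with the transported measure, then naturality of the quotient measure along the identity
  rw [hcan.classEpsOrbitalIntegral_mk_eq_epsOrbitalIntegral hΦ hreg (Measure.map eH τ₀) h1t φ]
  have hmap := map_cosetCongr_quotientMeasure (MulEquiv.refl (GtLoc L v)) he hes _ _ hHH τ₀ (Measure.map eH τ₀) νGt νGt rfl
    (by rw [MulEquiv.coe_refl, Measure.map_id])
  rw [← hmap]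
  unfold epsOrbitalIntegral
  rw [← coe_cosetCongrHomeomorph (MulEquiv.refl (GtLoc L v)) _ _ _ he hes, ← Homeomorph.toMeasurableEquiv_coe, integral_map_equiv]
  simp only [Homeomorph.toMeasurableEquiv_coe, coe_cosetCongrHomeomorph]
  refine integral_congr_ae (Filter.Eventually.of_forall fun q => ?_)
  exact descEpsConj_cosetCongr_refl_apply (epsLoc L Φ v) (epsCentralizer_le_of_mem_centralizer hΦ hγ ht hreg ht₀ hreg₀) le_rfl hHH φ q

/-- **CAN-ID, representative form**: under the same hypotheses, for every `x ∈ G̃_v` the integrand of the base integral at the coset `x G̃_{t₀ε}` is `φ(x t ε(x)⁻¹)` —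
`classEpsOrbitalIntegral mGt φ ⟦t⟧ = ∫ q, (descended `x ↦ φ(x t ε(x)⁻¹)`) d(dνGt ∕ dτ₀)` with ★ `descEpsConj_base_mk` for the pointwise reading; stated as the pair used by the
tube-map assembly. [cite: Rogawski1990, §12.5 p. 186; §4.10 (4.10.1) p. 57] -/
theorem IsEpsCanonicalAt.classEpsOrbitalIntegral_mk_eq_integral_base_and_mk
    (hΦ : ((Φ : GL (Fin 3) L) : Matrix (Fin 3) (Fin 3) L)ᵀ.map (IsCMField.complexConj L) = (Φ : Matrix (Fin 3) (Fin 3) L))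
    (hcan : IsEpsCanonicalAt L Φ v νGt mGt)
    {γ : (UnitaryGroup.cmDatum L 3 (Φ : Matrix (Fin 3) (Fin 3) L)).Local v} (hγ : IsRegularElt (γ.val : GtLoc L v))
    {t₀ : GtLoc L v} (ht₀ : t₀ ∈ Subgroup.centralizer ({(γ.val : GtLoc L v)} : Set (GtLoc L v))) (hreg₀ : IsEpsRegularAt L Φ v t₀)
    (τ₀ : Measure ↥(epsCentralizer (epsLoc L Φ v) t₀)) [τ₀.IsHaarMeasure] [τ₀.IsInvInvariant]
    (h1 : τ₀ (compactCore ↥(epsCentralizer (epsLoc L Φ v) t₀)) = 1)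
    {t : GtLoc L v} (ht : t ∈ Subgroup.centralizer ({(γ.val : GtLoc L v)} : Set (GtLoc L v))) (hreg : IsEpsRegularAt L Φ v t)
    {E : Type*} [NormedAddCommGroup E] [NormedSpace ℝ E] (φ : GtLoc L v → E) :
    classEpsOrbitalIntegral (epsLoc L Φ v) mGt φ
          (Quotient.mk (Relation.EqvGen.setoid (epsConjModRel (epsLoc L Φ v) ⊥)) t : EpsConjClassesMod (epsLoc L Φ v) ⊥) =
        ∫ q, descEpsConj (epsLoc L Φ v) t (epsCentralizer (epsLoc L Φ v) t₀) φ q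
          ∂(quotientMeasure (epsCentralizer (epsLoc L Φ v) t₀) τ₀ (isClosed_epsCentralizer L Φ v t₀) νGt) ∧
      ∀ x : GtLoc L v, descEpsConj (epsLoc L Φ v) t (epsCentralizer (epsLoc L Φ v) t₀) φ (QuotientGroup.mk x) = φ (x * t * (epsLoc L Φ v x)⁻¹) :=
  ⟨hcan.classEpsOrbitalIntegral_mk_eq_integral_descEpsConj_base hΦ hγ ht₀ hreg₀ τ₀ h1 ht hreg φ,
    descEpsConj_base_mk hΦ hγ ht hreg ht₀ hreg₀ φ⟩

/-- **INNER-C ON THE BASE**: under the hypotheses of CAN-ID, for `s ∈ T̃` the base integral at `t · s ε(s)⁻¹` equals the one at `t` —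
`∫ φ(x (t s ε(s)⁻¹) ε(x)⁻¹) d(dνGt∕dτ₀) = ∫ φ(x t ε(x)⁻¹) d(dνGt∕dτ₀)`: both are class ε-orbital integrals (CAN-ID) of the SAME class (§1).  So the inner integral of
T-WIF descends to `T̃ ⧸ (1−ε)T̃`. [cite: Rogawski1990, §12.5 p. 186] -/
theorem IsEpsCanonicalAt.integral_descEpsConj_base_mul_mul_epsLoc_inv
    (hΦ : ((Φ : GL (Fin 3) L) : Matrix (Fin 3) (Fin 3) L)ᵀ.map (IsCMField.complexConj L) = (Φ : Matrix (Fin 3) (Fin 3) L))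
    (hcan : IsEpsCanonicalAt L Φ v νGt mGt)
    {γ : (UnitaryGroup.cmDatum L 3 (Φ : Matrix (Fin 3) (Fin 3) L)).Local v} (hγ : IsRegularElt (γ.val : GtLoc L v))
    {t₀ : GtLoc L v} (ht₀ : t₀ ∈ Subgroup.centralizer ({(γ.val : GtLoc L v)} : Set (GtLoc L v))) (hreg₀ : IsEpsRegularAt L Φ v t₀)
    (τ₀ : Measure ↥(epsCentralizer (epsLoc L Φ v) t₀)) [τ₀.IsHaarMeasure] [τ₀.IsInvInvariant]
    (h1 : τ₀ (compactCore ↥(epsCentralizer (epsLoc L Φ v) t₀)) = 1)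
    {t s : GtLoc L v} (ht : t ∈ Subgroup.centralizer ({(γ.val : GtLoc L v)} : Set (GtLoc L v))) (hreg : IsEpsRegularAt L Φ v t)
    (hs : s ∈ Subgroup.centralizer ({(γ.val : GtLoc L v)} : Set (GtLoc L v)))
    {E : Type*} [NormedAddCommGroup E] [NormedSpace ℝ E] (φ : GtLoc L v → E) :
    ∫ q, descEpsConj (epsLoc L Φ v) (t * (s * (epsLoc L Φ v s)⁻¹)) (epsCentralizer (epsLoc L Φ v) t₀) φ q
        ∂(quotientMeasure (epsCentralizer (epsLoc L Φ v) t₀) τ₀ (isClosed_epsCentralizer L Φ v t₀) νGt) =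
      ∫ q, descEpsConj (epsLoc L Φ v) t (epsCentralizer (epsLoc L Φ v) t₀) φ q
        ∂(quotientMeasure (epsCentralizer (epsLoc L Φ v) t₀) τ₀ (isClosed_epsCentralizer L Φ v t₀) νGt) := by
  obtain ⟨hts, hregs, -⟩ := mem_centralizer_and_isEpsRegularAt_mul_mul_epsLoc_inv hΦ hγ ht hreg hs
  rw [← hcan.classEpsOrbitalIntegral_mk_eq_integral_descEpsConj_base hΦ hγ ht₀ hreg₀ τ₀ h1 hts hregs φ,
    ← hcan.classEpsOrbitalIntegral_mk_eq_integral_descEpsConj_base hΦ hγ ht₀ hreg₀ τ₀ h1 ht hreg φ]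
  exact classEpsOrbitalIntegral_mk_mul_mul_inv_eq_of_commute (epsLoc L Φ v) mGt φ (mul_comm_of_mem_centralizer_of_isRegularElt hγ hs ht)

end Base

end Summit.HodgeConjecture.HodgeConjecture.R90.S4

end
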